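import Summits.Ventures.CertifiedArithmetic.LowPrec.GemmThetaLawGenCert
import Summits.Ventures.CertifiedArithmetic.LowPrec.GemmThetaLawGenMixA
import Summits.Ventures.CertifiedArithmetic.LowPrec.GemmThetaLawGenMixB

/-!
# Letter-dependent symbolic θ-certificates: the three laws are θ-certificates at every precision

HONEST FRAMING (venture CertifiedArithmetic / cell `pub-lowprec`, seat gemm, gen 12 → 13): certified
error envelopes and provably optimal rounding/accumulation schemes for low-precision formats under
stated cost models; every table by two implementations; no hardware or vendor claims.

The end of the chain `GemmThetaLawGenDefs` (executable law check) → kernel tables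
(`lawCheck_e2m1`, `lawCheck_e2m3e2m1`, `lawCheck_e3m2e2m1`) → soundness (`GemmThetaLawGenSem` …
`GemmThetaLawGenCert`): for EVERY accumulator format `φ` of the stated precision whose exponent range
holds the product grid and the state range,
* `thetaCert_e2m1Law`: E2M1×E2M1 products (grid `1/4`), every `p = manBits + 1 ≥ 8`:
  `θ = (13·2^m + 16)/64`, `ρ = 7/2`, `β_pair = 23/2`, `κ = 64/(13·2^m + 16)`;
* `thetaCert_e2m3e2m1Law`: E2M3×E2M1 products (grid `1/16`), every `p ≥ 10`:
  `θ = (23·2^m + 32)/480`, `ρ = 31/2`, `β_pair = 95/2`, `κ = 256/(15·2^m + 16)`;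
* `thetaCert_e3m2e2m1Law`: E3M2×E2M1 products (grid `1/32`), every `p ≥ 13`:
  `θ = (65·2^m + 128)/512`, `ρ = 7/2`, `β_pair = 23/2`, `κ = 2048/(260·2^m + 512)`.
`ThetaCertificate.defect_bound` (file `GemmThetaCertificate`) then bounds the accumulated rounding
defect of sequential round-to-nearest-even accumulation of ANY word of such products, of any length,
by `(max ρ β_pair + κ)·(mass not absorbed)`-type envelopes (gemm.tex Prop. Θ(i)); the gen-12 theorem
`thetaCert_E2M1_prec` is the first instance with a hand-built certificate, these are generated.
-/

namespace Literature.ComputerArithmetic.FloatingPoint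

namespace MiniFloat

namespace ThetaLaw

/-- KERNEL FACT: continuity of the `ψ` tables of the E2M1 law. [cell] -/
theorem contOK_e2m1 : e2m1Law.contOK = true := by decide

/-- KERNEL FACT: continuity of the `ψ` tables of the E2M3×E2M1 law. [cell] -/
theorem contOK_e2m3e2m1 : e2m3e2m1Law.contOK = true := by decide

/-- KERNEL FACT: continuity of the `ψ` tables of the E3M2×E2M1 law. [cell] -/
theorem contOK_e3m2e2m1 : e3m2e2m1Law.contOK = true := by decide

/-- KERNEL FACT: the letters of the E2M1 law are at most `144` (`= 4·6·6`). [cell] -/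
theorem lam_bound_e2m1 : ∀ z ∈ e2m1Law.lam, z.natAbs ≤ 144 := by decide +kernel

/-- KERNEL FACT: the letters of the E2M3×E2M1 law are at most `720`. [cell] -/
theorem lam_bound_e2m3e2m1 : ∀ z ∈ e2m3e2m1Law.lam, z.natAbs ≤ 720 := by decide +kernel

/-- KERNEL FACT: the letters of the E3M2×E2M1 law are at most `5376`. [cell] -/
theorem lam_bound_e3m2e2m1 : ∀ z ∈ e3m2e2m1Law.lam, z.natAbs ≤ 5376 := by decide +kernel

/-- The precision parameter of a symbolic law with `M₀ = 2^a`, `K = 2^(m-a)`: the arithmetic side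
conditions of `lawCheck_cert`. [folklore] -/
theorem pow_params {m a : ℕ} (ha : a + 1 ≤ m) :
    (2 : ℤ) ^ m = 2 * 2 ^ (m - 1) ∧ (2 : ℤ) ^ a * 2 ^ (m - a) = 2 * 2 ^ (m - 1) ∧
      (2 : ℤ) ∣ 2 ^ (m - a) ∧ (2 : ℤ) ≤ 2 ^ (m - a) := by
  refine ⟨?_, ?_, ?_, ?_⟩
  · rw [← pow_succ']; congr 1; omega
  · rw [← pow_add, ← pow_succ']; congr 1; omega
  · exact dvd_pow_self 2 (by omega)
  · calc (2 : ℤ) = 2 ^ 1 := by norm_num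
      _ ≤ 2 ^ (m - a) := pow_le_pow_right₀ (by norm_num) (by omega)

/-- A bound `C < 2^(c)` on the letters transported to `2^(m+1)`, `c ≤ m + 1`. [folklore] -/
theorem lam_small {L : LawData} {C c : ℕ} (hC : C < 2 ^ c) (hb : ∀ z ∈ L.lam, z.natAbs ≤ C)
    {m : ℕ} (hm : c ≤ m + 1) : ∀ z ∈ L.lam, z.natAbs < 2 ^ (m + 1) :=
  fun z hz => (hb z hz).trans_lt (hC.trans_le (Nat.pow_le_pow_right (by norm_num) hm))

/-- THE E2M1×E2M1 LAW IS A θ-CERTIFICATE AT EVERY PRECISION `p ≥ 8` (grid `1/4`; exponent range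
`qexp ≤ -2`, `2^(m+10) ≤ maxRat`). [cell; kernel tables + soundness] -/
theorem thetaCert_e2m1Law (φ : Format) (hm : 7 ≤ φ.manBits) (hq : φ.qexp ≤ -2)
    (hR : (2 : ℚ) ^ (φ.manBits + 10) ≤ φ.maxRat) :
    ThetaCertificate φ (e2m1Law.PiL 2) (e2m1Law.SL 2 φ) (e2m1Law.psiL 2 φ)
      (e2m1Law.thetaL φ.manBits) e2m1Law.rhoL e2m1Law.betaL (e2m1Law.kappaL φ.manBits) := by
  obtain ⟨h1, h2, h3, h4⟩ := pow_params (a := 6) (by omega : 6 + 1 ≤ φ.manBits)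
  exact e2m1Law.lawCheck_cert lawCheck_e2m1 contOK_e2m1 succOK_e2m1 (K := 2 ^ (φ.manBits - 6))
    h1 (by rw [show e2m1Law.M0 = 2 ^ 6 from rfl]; exact h2) h3 h4 (fun h => absurd h (by decide))
    (G := 2) (by exact_mod_cast hq) hR
    (lam_small (c := 8) (by norm_num) lam_bound_e2m1 (by omega))
    (show (0 : ℤ) < 13 * 2 ^ φ.manBits + 16 by positivity) (by decide) (by decide)
    (show (0 : ℤ) < 13 * 2 ^ φ.manBits + 16 by positivity)

/-- THE E2M3×E2M1 LAW IS A θ-CERTIFICATE AT EVERY PRECISION `p ≥ 10` (grid `1/16`; exponent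
range `qexp ≤ -4`, `2^(m+12) ≤ maxRat`). [cell; kernel tables + soundness] -/
theorem thetaCert_e2m3e2m1Law (φ : Format) (hm : 9 ≤ φ.manBits) (hq : φ.qexp ≤ -4)
    (hR : (2 : ℚ) ^ (φ.manBits + 12) ≤ φ.maxRat) :
    ThetaCertificate φ (e2m3e2m1Law.PiL 4) (e2m3e2m1Law.SL 4 φ) (e2m3e2m1Law.psiL 4 φ)
      (e2m3e2m1Law.thetaL φ.manBits) e2m3e2m1Law.rhoL e2m3e2m1Law.betaL
      (e2m3e2m1Law.kappaL φ.manBits) := by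
  obtain ⟨h1, h2, h3, h4⟩ := pow_params (a := 8) (by omega : 8 + 1 ≤ φ.manBits)
  exact e2m3e2m1Law.lawCheck_cert lawCheck_e2m3e2m1 contOK_e2m3e2m1 succOK_e2m3e2m1
    (K := 2 ^ (φ.manBits - 8)) h1 (by rw [show e2m3e2m1Law.M0 = 2 ^ 8 from rfl]; exact h2) h3 h4
    (fun h => absurd h (by decide)) (G := 4) (by exact_mod_cast hq) hR
    (lam_small (c := 10) (by norm_num) lam_bound_e2m3e2m1 (by omega))
    (show (0 : ℤ) < 23 * 2 ^ φ.manBits + 32 by positivity) (by decide) (by decide)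
    (show (0 : ℤ) < 15 * 2 ^ φ.manBits + 16 by positivity)

/-- THE E3M2×E2M1 LAW IS A θ-CERTIFICATE AT EVERY PRECISION `p ≥ 13` (grid `1/32`; exponent
range `qexp ≤ -5`, `2^(m+15) ≤ maxRat`). [cell; kernel tables + soundness] -/
theorem thetaCert_e3m2e2m1Law (φ : Format) (hm : 12 ≤ φ.manBits) (hq : φ.qexp ≤ -5)
    (hR : (2 : ℚ) ^ (φ.manBits + 15) ≤ φ.maxRat) :
    ThetaCertificate φ (e3m2e2m1Law.PiL 5) (e3m2e2m1Law.SL 5 φ) (e3m2e2m1Law.psiL 5 φ)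
      (e3m2e2m1Law.thetaL φ.manBits) e3m2e2m1Law.rhoL e3m2e2m1Law.betaL
      (e3m2e2m1Law.kappaL φ.manBits) := by
  obtain ⟨h1, h2, h3, h4⟩ := pow_params (a := 11) (by omega : 11 + 1 ≤ φ.manBits)
  exact e3m2e2m1Law.lawCheck_cert lawCheck_e3m2e2m1 contOK_e3m2e2m1 succOK_e3m2e2m1
    (K := 2 ^ (φ.manBits - 11)) h1 (by rw [show e3m2e2m1Law.M0 = 2 ^ 11 from rfl]; exact h2) h3 h4
    (fun h => absurd h (by decide)) (G := 5) (by exact_mod_cast hq) hR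
    (lam_small (c := 13) (by norm_num) lam_bound_e3m2e2m1 (by omega))
    (show (0 : ℤ) < 65 * 2 ^ φ.manBits + 128 by positivity) (by decide) (by decide)
    (show (0 : ℤ) < 260 * 2 ^ φ.manBits + 512 by positivity)

/-- READING: the product alphabet of the E2M1 law is the signed E2M1×E2M1 products in quarters,
e.g. `9/4 = 1.5·1.5`, `36 = 6·6`, and `0`. [cell] -/
theorem piL_e2m1_values :
    e2m1Law.PiL 2 (9 / 4) ∧ e2m1Law.PiL 2 (-36) ∧ e2m1Law.PiL 2 0 :=
  ⟨⟨9, by decide, by norm_num⟩, ⟨-144, by decide, by norm_num⟩, ⟨0, by decide, by norm_num⟩⟩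

end ThetaLaw

end MiniFloat

end Literature.ComputerArithmetic.FloatingPoint
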